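import Summits.HodgeConjecture.HodgeConjecture.Theorems.HodgeSimilitudeAlgebraic.Negative.FalseWithoutHtype
import Summits.HodgeConjecture.HodgeConjecture.Theorems.NikulinTwinTransportTwinSimilitudeAlgebraicLattice
import Summits.HodgeConjecture.HodgeConjecture.Theorems.NikulinTwinTransportTwinSimilitudeAlgebraicMarkings

/-!
# `TwinSimilitudeAlgebraic` (stmt-HodgeConjecture-13674, X = Sim₂(K3)) · Negative · X is not vacuous

Negative-side knowledge for the crux `NikulinTwinTransport.TwinSimilitudeAlgebraic`, extracted from the
standing disprover's work file `Cruxes/TwinSimilitudeAlgebraic/Disproof.lean` (§4;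
refuter-cdisprove-stmt-HodgeConjecture-13674-0, cycle 1, 2026-08-16): the refuter's interface check
"does the hypothesis bundle have a NON-JUNK inhabitant?" answered positively, modulo two named facts of
the tree on K3 surfaces.

`hypotheses_inhabited`: granted the projective surjectivity of the period map
(`Huybrechts_K3_periodSurjective_projective`) and the Hodge types of `H²(K3)` through the period line
(`Huybrechts_K3_hodgeTypes_H2`), there are projective K3 surfaces `S, S′`, integral generators `p, p′`
of `H⁴` and an INJECTIVE `ℂ`-linear `ψ : H²(S′(ℂ);ℂ) → H²(S(ℂ);ℂ)` satisfying all hypotheses of X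
(rational, type-preserving for every `(i, j)`, doubling cup products). Construction: the explicit
rational lattice `2`-similitude `M` with rational inverse `N` (`exists_twoSimilitude_k3Lattice`), the
marked projective K3 surface with CM period `x₀ = (e₁+f₁) + i(e₂+f₂)` and the one with the TWIN period
`N x₀` (`periodPt_twin`), and `ψ = φ⁻¹ ∘ M ∘ φ′` (`isRationalClass_markingConj`,
`isOfHodgeType_markingConj`, `cupProduct_markingConj`). Consequently X cannot be closed by vacuity, and
a proof must produce an algebraic class on `S × S′` inducing this particular `ψ` — the twin transport of
the route. (The same construction sits inside the landed `twinSimilitudeAlgebraic_of_twinTransport`;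
here it is isolated as the non-vacuity certificate.)

## References

* [Huybrechts2016K3] D. Huybrechts, Lectures on K3 Surfaces (2016), Ch. 6 Prop. 1.2, Rem. 3.3; Ch. 7.
* [Buskin2019] N. Buskin, Every rational Hodge isometry between two K3 surfaces is algebraic,
  J. reine angew. Math. 755 (2019), §6.2.
-/

noncomputable section

open CategoryTheory MonoidalCategory
open scoped Manifold Matrix
open Literature.AlgebraicGeometry.Motives Literature.AlgebraicGeometry.HodgeTheory
open Literature.AlgebraicGeometry.Surfaces Literature.Geometry.Kaehler
open Literature.AlgebraicTopology.SingularHomology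
open Summit.HodgeConjecture.HodgeConjecture.Theses.NikulinTwinTransport
open Summit.HodgeConjecture.HodgeConjecture.Theorems.NikulinTwinTransport
open Summit.HodgeConjecture.HodgeConjecture.Theorems.HodgeSimilitudeAlgebraic.Negative

namespace Summit.HodgeConjecture.HodgeConjecture.Theorems.TwinSimilitudeAlgebraic.Negative

/-- The explicit projective CM period vector `x₀ = (e₁ + f₁) + i (e₂ + f₂)` (verbatim the local
notation of `HodgeSimilitudeAlgebraic/Negative/FalseWithoutHtype`). Local notation only. -/
local notation3 (prettyPrint := false) "x₀P" =>
  (Sum.elim 0 (Sum.elim ![1, 1] (Sum.elim ![Complex.I, Complex.I] 0)) : K3Index → ℂ)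

/-- The lattice vector `u = e₃ + f₃ ⊥ x₀`, `u² = 2`. Local notation only. -/
local notation3 (prettyPrint := false) "uV" =>
  (Sum.elim 0 (Sum.elim 0 (Sum.elim 0 ![1, 1])) : K3Index → ℤ)

/-- **X's hypotheses are inhabited (modulo the period fact and the Hodge-type fact), by an injective
`ψ` between two projective K3 surfaces.** Take the explicit rational lattice `2`-similitude `M` with
rational inverse `N` (`exists_twoSimilitude_k3Lattice`), the marked projective K3 surface `(S, φ, p)`
with period `x₀ = (e₁+f₁) + i(e₂+f₂)` and the marked projective K3 surface `(S′, φ′, p′)` with the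
TWIN period `N x₀` (a projective period point, `periodPt_twin`; both from
`Huybrechts_K3_periodSurjective_projective`). Then `ψ = φ⁻¹ ∘ M ∘ φ′ : H²(S′(ℂ);ℂ) → H²(S(ℂ);ℂ)` is
rational (`isRationalClass_markingConj`), preserves every Hodge type (`isOfHodgeType_markingConj`,
since `M N x₀ = x₀`; needs `Huybrechts_K3_hodgeTypes_H2`), doubles cup products for the generators
`p, p′` (`cupProduct_markingConj`), and is injective (`N M = 1`). So X is not vacuous for the right
reason: a proof must produce an algebraic class on `S × S′` inducing THIS `ψ` — exactly the twin
transport the route proposes. (The sibling's Transfer file uses the same construction inside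
`twinSimilitudeAlgebraic_of_twinTransport`; here it is isolated as the non-vacuity certificate of X.)
[cite: Huybrechts2016K3, Ch. 6 Rem. 3.3 and Ch. 7 (surjectivity of the period map)]
[cite: Buskin2019, §6.2] -/
theorem hypotheses_inhabited (hP : Huybrechts_K3_periodSurjective_projective)
    (hHT : Huybrechts_K3_hodgeTypes_H2) :
    ∃ (S S' : SchemeOver ℂ) (_ : IsK3Surface S) (_ : IsK3Surface S')
      (p : complexBetti S (2 * 2)) (p' : complexBetti S' (2 * 2))
      (ψ : complexBetti S' (2 * 1) →ₗ[ℂ] complexBetti S (2 * 1)),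
      (IsIntegralClass p ∧ ∀ q : complexBetti S (2 * 2), IsIntegralClass q → ∃ n : ℤ, q = n • p) ∧
      (IsIntegralClass p' ∧ ∀ q : complexBetti S' (2 * 2), IsIntegralClass q → ∃ n : ℤ, q = n • p') ∧
      (∀ x, IsRationalClass x → IsRationalClass (ψ x)) ∧
      (∀ (i j : ℕ) x, IsOfHodgeType 2 S' (2 * 1) i j x → IsOfHodgeType 2 S (2 * 1) i j (ψ x)) ∧
      (∀ (x y : complexBetti S' (2 * 1)) (a : ℂ),
          cupProduct (rfl : 2 * 1 + 2 * 1 = 2 * 2) x y = a • p' →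
            cupProduct (rfl : 2 * 1 + 2 * 1 = 2 * 2) (ψ x) (ψ y) = ((2 : ℂ) * a) • p) ∧
      Function.Injective ψ := by
  obtain ⟨M, N, hMrat, hNrat, hMN, hNM, hM2⟩ := exists_twoSimilitude_k3Lattice
  have hMN' : ∀ a, M (N a) = a := fun a => by
    rw [← Module.End.mul_apply, hMN, Module.End.one_apply]
  have hNM' : ∀ a, N (M a) = a := fun a => by
    rw [← Module.End.mul_apply, hNM, Module.End.one_apply]
  have hN2 : ∀ a b, k3Form (N a) (N b) = (2 : ℂ)⁻¹ * k3Form a b := by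
    intro a b
    have h := hM2 (N a) (N b)
    rw [hMN', hMN'] at h
    rw [h, ← mul_assoc, inv_mul_cancel₀ (two_ne_zero' ℂ), one_mul]
  -- the twin period `N x₀` is a projective period point
  obtain ⟨hx'1, hx'2, hx'3⟩ :=
    periodPt_twin N hNrat hN2 (x := x₀P) ⟨x₀P_sq, x₀P_pos, uV, uV_x₀P, uV_sq⟩
  -- the two marked projective K3 surfaces
  obtain ⟨S, hS, φ, p, hpint, hpgen, hφint, hφcup, h20, -⟩ :=
    hP x₀P x₀P_sq x₀P_pos ⟨uV, uV_x₀P, uV_sq⟩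
  obtain ⟨S', hS', φ', p', hp'int, hp'gen, hφ'int, hφ'cup, h20', -⟩ := hP (N x₀P) hx'1 hx'2 hx'3
  have hp'0 : p' ≠ 0 := generator_ne_zero hS' hp'gen
  have hper : ∃ t : ℂ, M (N x₀P) = t • x₀P := ⟨1, by rw [hMN', one_smul]⟩
  refine ⟨S, S', hS, hS', p, p', φ.symm.toLinearMap ∘ₗ M ∘ₗ φ'.toLinearMap, ⟨hpint, hpgen⟩,
    ⟨hp'int, hp'gen⟩, ?_, ?_, ?_, ?_⟩
  · exact fun y hy => isRationalClass_markingConj φ φ' M hS hS' hφint hφ'int hMrat hy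
  · exact isOfHodgeType_markingConj φ p x₀P φ' p' (N x₀P) M hHT hS hS' hφint hφcup h20 x₀P_pos
      hφ'int hφ'cup hp'0 h20' hx'2 hMrat two_ne_zero hM2 hper
  · exact fun y z a h => cupProduct_markingConj φ p φ' p' M hp'0 hφcup hφ'cup hM2 y z a h
  · intro y z hyz
    have h1 : M (φ' y) = M (φ' z) := φ.symm.injective hyz
    have h2 : φ' y = φ' z := by
      have := congrArg N h1
      rwa [hNM', hNM'] at this
    exact φ'.injective h2


end Summit.HodgeConjecture.HodgeConjecture.Theorems.TwinSimilitudeAlgebraic.Negative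

end
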